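import Summits.RiemannHypothesis.RiemannHypothesis.Theorems.PfPersistenceM2EvenSectorIndexLower
import Summits.RiemannHypothesis.RiemannHypothesis.Theorems.PfPersistenceM2RealSectorSecondLevel
import HarnessLib

/-!
# PF-persistence, M2 seat (gen 5), part 3 (index language): the negative EVEN index EQUALS `K`; the second REAL level is RH-equivalent; the typed strength of M2-G2

pub-rhpf cell, M2 seat, generation 5.  HONEST FRAMING: long-odds MECHANISM SEARCH; no RH claims.
Labels: PROVED (kernel) / CITED (Bombieri 2000, Rend. Lincei (9) 11) / HYPOTHESIS (explicit binder).

`EvenNegIndexAtLeast n a`: there are `n` even real-valued Weil tests supported in `[-a, a]` on whose real span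
`Re Q` (`Q = weilQuadratic`, untruncated) is negative definite.  `𝒬` = non-trivial zeros with `Re ρ > 1/2`,
`Im ρ > 0`; `K = #𝒬`.

PROVED (all RH-free):
* upper half (gen 4 repackaged): `EvenNegIndexAtLeast n a → n ≤ 𝒬.encard` (`le_encard_quadrant_of_evenNegIndexAtLeast`);
* lower half (part 2 repackaged): `𝒬` finite, `n ≤ K` ⟹ `EvenNegIndexAtLeast n a` for all long windows
  (`evenNegIndexAtLeast_of_finite`); hence `exists_evenNegIndexAtLeast_iff`: `(∃ a, EvenNegIndexAtLeast n a) ↔ n ≤ K`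
  — the negative index of the even real Weil form on long windows is EXACTLY `K` [CITED shape: Bombieri 2000
  Thm 9, even part, for truncations; here untruncated and window-uniform];
* M2-G2 STRENGTH, typed (`not_evenNegIndexAtLeast_two_iff`): under finiteness, "no window carries two independent
  negative even directions" (the second even level of `Re Q` never goes negative) `↔ K ≤ 1`; unconditionally
  (`quadrant_infinite_or_encard_le_one`) the same invariant yields `𝒬 infinite ∨ K ≤ 1`, and conversely `K ≤ 1`
  forbids a second negative even direction at every window (`not_evenNegIndexAtLeast_two_of_encard_le_one`);
  under RH there is none at all (`not_evenNegIndexAtLeast_succ_of_riemannHypothesis`).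

* the FULL REAL form (section E, from part 4 `PfPersistenceM2RealSectorSecondLevel`): `RealNegIndexAtLeast n a`
  (real-valued tests, no parity); `riemannHypothesis_iff_forall_not_realNegIndexAtLeast_two` — RH ⟺ no window
  carries TWO independent real negative directions (one even + one odd direction exist off RH, `Q`-orthogonal
  sectors; NO finiteness hypothesis), and `…_one` (Weil's criterion); `evenBlind_realSees_of_card_eq_one`: with
  exactly one off-line quadruple the second EVEN level is `≥ 0` at every window while the second REAL level goes
  negative — the even sector is blind to `K = 1`, the full form is not [CITED shape: Bombieri 2000 Thm 8 vs Thm 9].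

READING for the M2 route (proved vs conjectured, as the cell brief demands): the second-even-level invariant is
STRICTLY WEAKER than RH (it cannot see one off-line quadruple) and therefore NOT an RH-strength input; RH-free it
certifies exactly "at most one exceptional quadruple, or infinitely many".  Its only undecided configuration is the
typed open residue `K = ∞` (in print: Bombieri 2000, Cor. to Thm 11).  An `a`-uniform lower bound on the FIRST
even level, `ε₁(a) ≥ 0 ∀ a`, is Weil positivity on even real tests, i.e. RH-strength (Weil's criterion, tree
`WeilCriterionConverse`) — which is why the M2 closing input (iv) of the seat brief stays RH-strength; nothing in
this packet lowers it.
-/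

noncomputable section

set_option linter.dupNamespace false

open Complex Filter Set MeasureTheory
open scoped Real Topology ComplexConjugate BigOperators

namespace Summit.RiemannHypothesis.RiemannHypothesis.Theorems.PfPersistenceM2NegIndex

open Literature.NumberTheory.LFunctions
open Literature.NumberTheory.LFunctions.WeilConverse
open Literature.NumberTheory.LFunctions.ZetaZeros
open Summit.RiemannHypothesis.RiemannHypothesis.Theorems.PolarPerronFrobenius
  (evenNegativity_exists_even_real_neg)

/-! ## D. The index language -/

/-- "The even real Weil form has negative index at least `n` on the window `[-a, a]`": there are `n` even,
real-valued Weil test functions supported in `[-a, a]` on whose REAL span `Re Q` is negative definite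
(negative definiteness forces linear independence, so this is a genuine `n`-dimensional negative subspace).
[cite: Bombieri2000Weil, Thm 9] -/
def EvenNegIndexAtLeast (n : ℕ) (a : ℝ) : Prop :=
  ∃ g : Fin n → ℝ → ℂ, (∀ i, IsWeilTest (g i)) ∧ (∀ i (t : ℝ), g i (-t) = g i t) ∧
    (∀ i (t : ℝ), (g i t).im = 0) ∧ (∀ i, tsupport (g i) ⊆ Icc (-a) a) ∧
    ∀ c : Fin n → ℝ, c ≠ 0 → (weilQuadratic (fun t : ℝ ↦ ∑ i, (c i : ℂ) * g i t)).re < 0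

/-- Monotonicity in the window. [folklore] -/
theorem EvenNegIndexAtLeast.mono {n : ℕ} {a b : ℝ} (h : EvenNegIndexAtLeast n a) (hab : a ≤ b) :
    EvenNegIndexAtLeast n b := by
  obtain ⟨g, h1, h2, h3, h4, h5⟩ := h
  exact ⟨g, h1, h2, h3, fun i ↦ (h4 i).trans (Icc_subset_Icc (neg_le_neg hab) hab), h5⟩

/-- **Upper half** (gen 4, `card_le_encard_quadrant_of_negative_family`): negative even index `≥ n` at some
window forces at least `n` zeros of `ζ` in the open quadrant `Re ρ > 1/2, Im ρ > 0`.
[cite: Bombieri2000Weil, Thm 9 (even part)] -/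
theorem le_encard_quadrant_of_evenNegIndexAtLeast {n : ℕ} {a : ℝ} (h : EvenNegIndexAtLeast n a) :
    (n : ℕ∞) ≤ {ρ : ℂ | ρ ∈ riemannZetaNontrivialZeros ∧ 1 / 2 < ρ.re ∧ 0 < ρ.im}.encard := by
  obtain ⟨g, h1, h2, h3, -, h5⟩ := h
  simpa using card_le_encard_quadrant_of_negative_family g h1 h2 h3 h5

/-- **Lower half** (this file): with finitely many quadrant zeros, every `n ≤ K` is attained as negative even
index on ALL sufficiently long windows. [cite: Bombieri2000Weil, Thm 9 (even part); Thm 11] -/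
theorem evenNegIndexAtLeast_of_finite
    (hfin : {ρ : ℂ | ρ ∈ riemannZetaNontrivialZeros ∧ 1 / 2 < ρ.re ∧ 0 < ρ.im}.Finite) {n : ℕ}
    (hn : n ≤ hfin.toFinset.card) : ∃ A : ℝ, ∀ a : ℝ, A ≤ a → EvenNegIndexAtLeast n a := by
  obtain ⟨A, g, h1, h2, h3, h4, h5⟩ := exists_negative_definite_even_family_of_finite hfin hn
  exact ⟨A, fun a ha ↦ EvenNegIndexAtLeast.mono ⟨g, h1, h2, h3, h4, h5⟩ ha⟩

/-- **The negative even index on long windows equals the number `K` of off-line quadruples** (when `K < ∞`):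
`(∃ a, index ≥ n on [-a, a]) ↔ n ≤ K`. [cite: Bombieri2000Weil, Thm 9 (even part)] -/
theorem exists_evenNegIndexAtLeast_iff
    (hfin : {ρ : ℂ | ρ ∈ riemannZetaNontrivialZeros ∧ 1 / 2 < ρ.re ∧ 0 < ρ.im}.Finite) (n : ℕ) :
    (∃ a : ℝ, EvenNegIndexAtLeast n a) ↔ n ≤ hfin.toFinset.card := by
  constructor
  · rintro ⟨a, ha⟩
    have h := le_encard_quadrant_of_evenNegIndexAtLeast ha
    rw [hfin.encard_eq_coe_toFinset_card] at h
    exact_mod_cast h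
  · intro hn
    obtain ⟨A, hA⟩ := evenNegIndexAtLeast_of_finite hfin hn
    exact ⟨A, hA A le_rfl⟩

/-- **M2-G2 strength, typed (pub-rhpf M2 seat).**  Under finitely many off-line zeros, "no window carries TWO
independent negative even directions" (the second even level never goes negative) holds IF AND ONLY IF there is at
most ONE off-line quadruple.  So the second-level invariant is strictly weaker than RH by exactly the `K = 1`
configurations (and the `K = ∞` residue below); it is NOT an RH-strength input. [cite: Bombieri2000Weil, Thm 9; Thm 11] -/
theorem not_evenNegIndexAtLeast_two_iff
    (hfin : {ρ : ℂ | ρ ∈ riemannZetaNontrivialZeros ∧ 1 / 2 < ρ.re ∧ 0 < ρ.im}.Finite) :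
    (∀ a : ℝ, ¬ EvenNegIndexAtLeast 2 a) ↔ hfin.toFinset.card ≤ 1 := by
  have h := exists_evenNegIndexAtLeast_iff hfin 2
  constructor
  · intro hno
    by_contra hlt
    obtain ⟨a, ha⟩ := h.2 (by omega)
    exact hno a ha
  · intro hle a ha
    have h2 := h.1 ⟨a, ha⟩
    omega

/-- Unconditional reading of the second even level: if no window carries two negative even directions, then
EITHER infinitely many zeros lie in the open quadrant (the typed open residue `K = ∞`, where compactly supported
probes cannot separate the tail) OR there is at most one off-line quadruple. [cite: Bombieri2000Weil, Thm 11] -/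
theorem quadrant_infinite_or_encard_le_one (hno : ∀ a : ℝ, ¬ EvenNegIndexAtLeast 2 a) :
    {ρ : ℂ | ρ ∈ riemannZetaNontrivialZeros ∧ 1 / 2 < ρ.re ∧ 0 < ρ.im}.Infinite ∨
      {ρ : ℂ | ρ ∈ riemannZetaNontrivialZeros ∧ 1 / 2 < ρ.re ∧ 0 < ρ.im}.encard ≤ 1 := by
  by_cases hfin : {ρ : ℂ | ρ ∈ riemannZetaNontrivialZeros ∧ 1 / 2 < ρ.re ∧ 0 < ρ.im}.Finite
  · right
    rw [hfin.encard_eq_coe_toFinset_card]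
    exact_mod_cast (not_evenNegIndexAtLeast_two_iff hfin).1 hno
  · exact Or.inl hfin

/-- Conversely, at most one off-line quadruple forbids a second negative even direction at every window
(RH-free; the gen-4 count). [cite: Bombieri2000Weil, Thm 9 (even part)] -/
theorem not_evenNegIndexAtLeast_two_of_encard_le_one
    (h : {ρ : ℂ | ρ ∈ riemannZetaNontrivialZeros ∧ 1 / 2 < ρ.re ∧ 0 < ρ.im}.encard ≤ 1) (a : ℝ) :
    ¬ EvenNegIndexAtLeast 2 a := fun h2 ↦ by
  have h3 := (le_encard_quadrant_of_evenNegIndexAtLeast h2).trans h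
  norm_num at h3

/-- **General level `n`** (same count): under finitely many quadrant zeros, "no window carries `n + 1`
independent negative even directions" (the `(n+1)`-st even level never goes negative) holds IF AND ONLY IF there are
at most `n` off-line quadruples — the hierarchy of level-sign statements is exactly the hierarchy `K ≤ n`; only
`n = 0` (Weil positivity in the even sector) is RH-strength. [cite: Bombieri2000Weil, Thm 9 (even part); Thm 11] -/
theorem not_evenNegIndexAtLeast_succ_iff
    (hfin : {ρ : ℂ | ρ ∈ riemannZetaNontrivialZeros ∧ 1 / 2 < ρ.re ∧ 0 < ρ.im}.Finite) (n : ℕ) :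
    (∀ a : ℝ, ¬ EvenNegIndexAtLeast (n + 1) a) ↔ hfin.toFinset.card ≤ n := by
  have h := exists_evenNegIndexAtLeast_iff hfin (n + 1)
  constructor
  · intro hno
    by_contra hlt
    obtain ⟨a, ha⟩ := h.2 (by omega)
    exact hno a ha
  · intro hle a ha
    have h2 := h.1 ⟨a, ha⟩
    omega

/-- Unconditional reading at level `n`: no window with `n + 1` negative even directions ⇒ EITHER infinitely many
quadrant zeros (the open residue `K = ∞`) OR at most `n` off-line quadruples. [cite: Bombieri2000Weil, Thm 11] -/
theorem quadrant_infinite_or_encard_le (n : ℕ) (hno : ∀ a : ℝ, ¬ EvenNegIndexAtLeast (n + 1) a) :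
    {ρ : ℂ | ρ ∈ riemannZetaNontrivialZeros ∧ 1 / 2 < ρ.re ∧ 0 < ρ.im}.Infinite ∨
      {ρ : ℂ | ρ ∈ riemannZetaNontrivialZeros ∧ 1 / 2 < ρ.re ∧ 0 < ρ.im}.encard ≤ n := by
  by_cases hfin : {ρ : ℂ | ρ ∈ riemannZetaNontrivialZeros ∧ 1 / 2 < ρ.re ∧ 0 < ρ.im}.Finite
  · right
    rw [hfin.encard_eq_coe_toFinset_card]
    exact_mod_cast (not_evenNegIndexAtLeast_succ_iff hfin n).1 hno
  · exact Or.inl hfin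

/-- Conversely (RH-free, no finiteness hypothesis): at most `n` off-line quadruples forbid `n + 1` independent
negative even directions at every window. [cite: Bombieri2000Weil, Thm 9 (even part)] -/
theorem not_evenNegIndexAtLeast_succ_of_encard_le {n : ℕ}
    (h : {ρ : ℂ | ρ ∈ riemannZetaNontrivialZeros ∧ 1 / 2 < ρ.re ∧ 0 < ρ.im}.encard ≤ n) (a : ℝ) :
    ¬ EvenNegIndexAtLeast (n + 1) a := fun h2 ↦ by
  have h3 := (le_encard_quadrant_of_evenNegIndexAtLeast h2).trans h
  have h4 : n + 1 ≤ n := by exact_mod_cast h3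
  omega

/-- Under RH the even real Weil form has NO negative direction at any window (the quadrant is empty).
[cite: Bombieri2000Weil, Thm 1] -/
theorem not_evenNegIndexAtLeast_succ_of_riemannHypothesis (hRH : RiemannHypothesis) (n : ℕ) (a : ℝ) :
    ¬ EvenNegIndexAtLeast (n + 1) a := fun h ↦ by
  have hempty : {ρ : ℂ | ρ ∈ riemannZetaNontrivialZeros ∧ 1 / 2 < ρ.re ∧ 0 < ρ.im} = ∅ := by
    ext ρ
    simp only [mem_setOf_eq, mem_empty_iff_false, iff_false, not_and, not_lt]
    intro hρ hre
    exfalso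
    have h1 : ρ.re = 1 / 2 := hRH ρ (riemannZetaNontrivialZeros.zeta_eq_zero hρ) (by
      rintro ⟨k, hk⟩
      have h1 : ρ.re = -2 * ((k : ℝ) + 1) := by rw [hk]; simp
      have h2 : (0 : ℝ) ≤ k := k.cast_nonneg
      linarith) (riemannZetaNontrivialZeros.ne_one hρ)
    linarith
  have h2 := le_encard_quadrant_of_evenNegIndexAtLeast h
  rw [hempty, encard_empty] at h2
  simp at h2

/-! ## E. The full REAL form: its second level is RH-equivalent (contrast with D) -/

/-- "The full real Weil form has negative index at least `n` on the window `[-a, a]`": `n` REAL-valued Weil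
tests (no parity constraint) supported in `[-a, a]` on whose real span `Re Q` is negative definite.
[cite: Bombieri2000Weil, Thm 8] -/
def RealNegIndexAtLeast (n : ℕ) (a : ℝ) : Prop :=
  ∃ g : Fin n → ℝ → ℂ, (∀ i, IsWeilTest (g i)) ∧ (∀ i (t : ℝ), (g i t).im = 0) ∧
    (∀ i, tsupport (g i) ⊆ Icc (-a) a) ∧
    ∀ c : Fin n → ℝ, c ≠ 0 → (weilQuadratic (fun t : ℝ ↦ ∑ i, (c i : ℂ) * g i t)).re < 0

/-- Monotonicity in the window. [folklore] -/
theorem RealNegIndexAtLeast.mono {n : ℕ} {a b : ℝ} (h : RealNegIndexAtLeast n a) (hab : a ≤ b) :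
    RealNegIndexAtLeast n b := by
  obtain ⟨g, h1, h2, h3, h4⟩ := h
  exact ⟨g, h1, h2, fun i ↦ (h3 i).trans (Icc_subset_Icc (neg_le_neg hab) hab), h4⟩

/-- Even negative directions are in particular real negative directions. [folklore] -/
theorem EvenNegIndexAtLeast.toReal {n : ℕ} {a : ℝ} (h : EvenNegIndexAtLeast n a) :
    RealNegIndexAtLeast n a := by
  obtain ⟨g, h1, -, h3, h4, h5⟩ := h
  exact ⟨g, h1, h3, h4, h5⟩

/-- Under RH the full real form has no negative direction at any window (Weil positivity,
`weil_criterion_holds`). [cite: Bombieri2000Weil, Thm 2] -/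
theorem not_realNegIndexAtLeast_succ_of_riemannHypothesis (hRH : RiemannHypothesis) (n : ℕ) (a : ℝ) :
    ¬ RealNegIndexAtLeast (n + 1) a := by
  rintro ⟨g, hg, -, -, hneg⟩
  have hpos : WeilPositivity := weil_criterion_holds.1 hRH
  have hc : (Pi.single 0 1 : Fin (n + 1) → ℝ) ≠ 0 := fun h ↦ by
    have := congrFun h 0
    simp at this
  exact absurd (hneg _ hc) (not_lt.2 (hpos _ (isWeilTest_finset_sum _ fun i _ ↦ (hg i).const_mul _)))

/-- **Off RH: real negative index `≥ 2` on all long windows** (part 4,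
`exists_negative_definite_real_pair_of_not_riemannHypothesis`: one even + one odd direction, `Q`-orthogonal;
NO finiteness hypothesis). [cite: Bombieri2000Weil, Thm 8; Yoshida1992HermitianForms, Prop. 1] -/
theorem realNegIndexAtLeast_two_of_not_riemannHypothesis (hRH : ¬ RiemannHypothesis) :
    ∃ A : ℝ, ∀ a : ℝ, A ≤ a → RealNegIndexAtLeast 2 a :=
  exists_negative_definite_real_pair_of_not_riemannHypothesis hRH

/-- Off RH: real negative index `≥ 1` on all long windows (the even witness alone).
[cite: Yoshida1992HermitianForms, Prop. 1] -/
theorem realNegIndexAtLeast_one_of_not_riemannHypothesis (hRH : ¬ RiemannHypothesis) :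
    ∃ A : ℝ, ∀ a : ℝ, A ≤ a → RealNegIndexAtLeast 1 a := by
  obtain ⟨A, hA⟩ := realNegIndexAtLeast_two_of_not_riemannHypothesis hRH
  refine ⟨A, fun a ha ↦ ?_⟩
  obtain ⟨g, hg, hr, hs, hneg⟩ := hA a ha
  refine ⟨fun _ ↦ g 0, fun _ ↦ hg 0, fun _ t ↦ hr 0 t, fun _ ↦ hs 0, fun c hc ↦ ?_⟩
  have hc0 : c 0 ≠ 0 := fun h ↦ hc (funext fun i ↦ by fin_cases i; exact h)
  have hc' : (fun i : Fin 2 ↦ if i = 0 then c 0 else 0) ≠ 0 := fun h ↦ by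
    have := congrFun h 0
    simp only [↓reduceIte, Pi.zero_apply] at this
    exact hc0 this
  have e : (fun t : ℝ ↦ ∑ i : Fin 1, (c i : ℂ) * g 0 t) =
      fun t : ℝ ↦ ∑ i : Fin 2, (((fun i : Fin 2 ↦ if i = 0 then c 0 else 0) i : ℝ) : ℂ) * g i t := by
    funext t
    simp [Fin.sum_univ_two]
  rw [e]
  exact hneg _ hc'

/-- **The second level of the FULL real Weil form is RH-equivalent**: RH ⟺ no window carries two independent
real negative directions.  CONTRAST with `not_evenNegIndexAtLeast_two_iff`: in the EVEN sector the same statement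
is (under `K < ∞`) equivalent to `K ≤ 1`, not to RH. [cite: Bombieri2000Weil, Thm 2, Thm 8, Thm 9] -/
theorem riemannHypothesis_iff_forall_not_realNegIndexAtLeast_two :
    RiemannHypothesis ↔ ∀ a : ℝ, ¬ RealNegIndexAtLeast 2 a := by
  refine ⟨fun hRH a ↦ not_realNegIndexAtLeast_succ_of_riemannHypothesis hRH 1 a, fun h ↦ ?_⟩
  by_contra hRH
  obtain ⟨A, hA⟩ := realNegIndexAtLeast_two_of_not_riemannHypothesis hRH
  exact h A (hA A le_rfl)

/-- The first level too (Weil's criterion on real tests, even sector suffices): RH ⟺ no window carries a real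
negative direction. [cite: Bombieri2000Weil, Thm 2] -/
theorem riemannHypothesis_iff_forall_not_realNegIndexAtLeast_one :
    RiemannHypothesis ↔ ∀ a : ℝ, ¬ RealNegIndexAtLeast 1 a := by
  refine ⟨fun hRH a ↦ not_realNegIndexAtLeast_succ_of_riemannHypothesis hRH 0 a, fun h ↦ ?_⟩
  by_contra hRH
  obtain ⟨A, hA⟩ := realNegIndexAtLeast_one_of_not_riemannHypothesis hRH
  exact h A (hA A le_rfl)

/-- **The contrast in one statement** (under finitely many off-line zeros, `1 ≤ K`): the second EVEN level is
non-negative at every window iff `K = 1`, while the second REAL level is negative on some window (always, off RH).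
So an off-RH world with exactly one quadruple is invisible to the even second level and visible to the full one.
[cite: Bombieri2000Weil, Thm 8, Thm 9] -/
theorem evenBlind_realSees_of_card_eq_one
    (hfin : {ρ : ℂ | ρ ∈ riemannZetaNontrivialZeros ∧ 1 / 2 < ρ.re ∧ 0 < ρ.im}.Finite)
    (hK : hfin.toFinset.card = 1) :
    (∀ a : ℝ, ¬ EvenNegIndexAtLeast 2 a) ∧ ∃ a : ℝ, RealNegIndexAtLeast 2 a := by
  refine ⟨(not_evenNegIndexAtLeast_two_iff hfin).2 hK.le, ?_⟩
  have hRH : ¬ RiemannHypothesis := by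
    intro hRH
    obtain ⟨ρ, hρ⟩ := Finset.card_pos.1 (by omega : 0 < hfin.toFinset.card)
    rw [Set.Finite.mem_toFinset] at hρ
    obtain ⟨hz, hre, -⟩ := hρ
    have h1 : ρ.re = 1 / 2 := hRH ρ (riemannZetaNontrivialZeros.zeta_eq_zero hz) (by
      rintro ⟨k, hk⟩
      have h1 : ρ.re = -2 * ((k : ℝ) + 1) := by rw [hk]; simp
      have h2 : (0 : ℝ) ≤ k := k.cast_nonneg
      linarith) (riemannZetaNontrivialZeros.ne_one hz)
    linarith
  obtain ⟨A, hA⟩ := realNegIndexAtLeast_two_of_not_riemannHypothesis hRH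
  exact ⟨A, hA A le_rfl⟩

end Summit.RiemannHypothesis.RiemannHypothesis.Theorems.PfPersistenceM2NegIndex

end
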